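import Summits.AtomisticToContinuum.HydrodynamicLimit.Theorems.OneFlightGossipEngineCollisionActivityTailsOneWindowTails
import Summits.AtomisticToContinuum.HydrodynamicLimit.Theorems.OneFlightGossipEngineCollisionActivityTailsEndpointKinematics
import Summits.AtomisticToContinuum.HydrodynamicLimit.Theorems.OneFlightGossipEngineCollisionActivityTailsMeanEnergyBound
import Summits.AtomisticToContinuum.HydrodynamicLimit.Theorems.OneFlightGossipEngineCollisionActivityTailsEndpointTails
import HarnessLib

/-!
# `CollisionActivityTails` (stmt-AtomisticToContinuum-13734), line `SketchK1`: the REDUCTION of the crux to the two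
tail statements of the near-field kinetic energy and of the crowded collisional activity

Helper file (`--supports stmt-AtomisticToContinuum-13734`) for the crux
`Summit.AtomisticToContinuum.HydrodynamicLimit.Theses.TwoClocks.CollisionActivityTails` (≡ the byte-identical
`…Theses.OneFlightGossipEngine.CollisionActivityTails`). It records, sorry-free and over LANDED vocabulary only, the net theorem of
line `SketchK1` (leads prover-line-stmt-AtomisticToContinuum-13734-0 … -c5-0, cycles 1–6): the crux follows from the crux-shaped
tail statements (`CollisionActivityTailsWindowAlgebra.TailStatement`, p115960) of two window functionals of the landed lever file
`…ActivityDomination` (p94309),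

* `F² = nearFieldKinetic` — the window-averaged near-field relative kinetic energy (the line's open stub B′,
  `NearFieldKineticTails`, p106773 `↔ TailStatement F²` by p117971), and
* `Fcr = crowdedActivity` — the crowded collisional activity (the line's open stub A′, `CrowdedCollisionTails ≡ TailStatement Fcr`):

`collisionActivityTails_of_tailStatements : TailStatement F² → TailStatement Fcr → TwoClocks.CollisionActivityTails`, and, by the
landed one-window equivalences (p115960/p117971), the same from the ONE-WINDOW forms
(`collisionActivityTails_of_oneWindow`): per level and accuracy, ONE mesoscopic window scale that is good for `F²` and one that is
good for `Fcr`, uniformly in the start `s ≤ t` and in large `N`, already give the crux.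

Mechanism. Pathwise on the good set the landed lever `stub_activityDomination` gives `a_i ≤ F¹_i + C (F²_i + Fcr_i)` with the
endpoint term `F¹`; the three-term tail algebra (§2: on `{a > V}` the largest of three nonnegative summands exceeds a third of the
level) turns this into `𝟙{V < a_i} a_i ≤ 3C' Σ_m 𝟙{V' < F^m_i} F^m_i`, `C' = max C 1`, `V' = V/(3C')`; the endpoint tail is the
landed `stub_endpointTails stub_endpointKinematics stub_meanEnergyBound` (p89060/p86808/p88348: Chebyshev + packing + energy
conservation + Gaussian marginals), the other two are the hypotheses. Quantifier bookkeeping `σ₀ = min`, `V₀ = 3C' max(V₀², V₀³)`,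
`τ₀ = max`, `N₀ = max`; the `lintegral` of the sum splits because the endpoint and near-field tail sums are a.e.-measurable
(`lintegral_add_left'`). Nothing here is new mathematics; the two hypotheses are the open, crux-sized statements (see the crux's
`PROMOTE.md` / `Lines/SketchK1.dead.md`): this file only makes the line's reduction importable, so that proofs of the two tail
statements close the crux by a three-line file.

References: C. Cercignani, R. Illner, M. Pulvirenti, *The Mathematical Theory of Dilute Gases* (1994), §4.2, App. 4.A
(collision sums along the hard-sphere flow); H. Spohn, *Large Scale Dynamics of Interacting Particles* (1991), Part I §2.3
(local Gibbs states). Elementary; recorded here.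
-/

noncomputable section

open MeasureTheory Set Filter Topology
open scoped ENNReal

namespace Summit.AtomisticToContinuum.HydrodynamicLimit.Theorems.CollisionActivityTailsReduction

open Literature.MathematicalPhysics.KineticTheory Literature.Analysis.FluidPDE
open Summit.AtomisticToContinuum.HydrodynamicLimit.Theorems.CollisionActivityTailsActivityDomination
open Summit.AtomisticToContinuum.HydrodynamicLimit.Theorems.CollisionActivityTailsNearFieldKineticTails (tailFn
  tailFn_of_lt tailFn_of_le tailFn_nonneg aemeasurable_sum_tailFn_nearFieldKinetic)
open Summit.AtomisticToContinuum.HydrodynamicLimit.Theorems.CollisionActivityTailsWindowAlgebra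

/-! ## §1 The endpoint tail statement (landed), restated over the lever file's vocabulary -/

/-- **ENDPOINT TAILS** (landed: `…EndpointTails.stub_endpointTails` p89060 applied to `…EndpointKinematics.stub_endpointKinematics`
p86808 and `…MeanEnergyBound.stub_meanEnergyBound` p88348; the three files carry byte-identical copies of the vocabulary, so the
statement below — over `…ActivityDomination.endpointTerm` and `…NearFieldKineticTails.tailFn` — is definitionally the landed one):
for `0 < σ < σ₀`, every level `V > 0` and accuracy `ε > 0` there is `τ₀` such that for `τ ≥ τ₀`, all `N`, flows and starts, the
tail sum of the endpoint terms is a.e.-measurable and `E[(N+1)⁻¹ Σ_i 𝟙{V < F¹_i} F¹_i] ≤ ε`. -/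
theorem endpointTails_holds :
    ∀ (a₀ θ₀ : T3 → ℝ) (u₀ : T3 → V3), Continuous a₀ → Continuous θ₀ → Continuous u₀ →
    (∀ x, 0 < a₀ x) → (∀ x, 0 < θ₀ x) → ∃ σ₀ : ℝ, 0 < σ₀ ∧ ∀ σ : ℝ, 0 < σ → σ < σ₀ →
    ∀ V : ℝ, 0 < V → ∀ ε : ℝ, 0 < ε → ∃ τ₀ : ℝ, 0 < τ₀ ∧ ∀ τ : ℝ, τ₀ ≤ τ →
    ∀ (N : ℕ) (Φ : Flow σ N) (s : ℝ),
      AEMeasurable (fun z => ∑ i : Fin (N + 1), tailFn V (endpointTerm Φ τ s i z))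
          (localGibbsLaw σ a₀ u₀ θ₀ N Φ) ∧
      ∫⁻ z, ENNReal.ofReal (((N : ℝ) + 1)⁻¹ * ∑ i : Fin (N + 1), tailFn V (endpointTerm Φ τ s i z))
        ∂(localGibbsLaw σ a₀ u₀ θ₀ N Φ) ≤ ENNReal.ofReal ε :=
  CollisionActivityTailsEndpointTails.stub_endpointTails
    CollisionActivityTailsEndpointKinematics.stub_endpointKinematics
    CollisionActivityTailsMeanEnergyBound.stub_meanEnergyBound

/-! ## §2 Tail algebra and `lintegral` bookkeeping -/

/-- Scaling: `𝟙{V < c y} (c y) = c · 𝟙{V/c < y} y` for `c > 0`. -/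
theorem tailFn_mul {V c y : ℝ} (hc : 0 < c) : tailFn V (c * y) = c * tailFn (V / c) y := by
  by_cases h : V / c < y
  · have h' : V < c * y := by rwa [div_lt_iff₀' hc] at h
    rw [tailFn_of_lt h, tailFn_of_lt h']
  · have h' : c * y ≤ V := by
      have := not_lt.1 h
      rwa [← le_div_iff₀' hc]
    rw [tailFn_of_le (not_lt.1 h), tailFn_of_le h', mul_zero]

/-- **Three-term tail algebra.** If `a ≤ x₁ + x₂ + x₃` with `xₘ ≥ 0`, then
`𝟙{V < a} a ≤ 3 (𝟙{V/3 < x₁} x₁ + 𝟙{V/3 < x₂} x₂ + 𝟙{V/3 < x₃} x₃)`: on `{a > V}` the largest `xₘ` exceeds `V/3`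
and `a ≤ 3 max ≤ 3 Σ tails`. -/
theorem tailFn_le_three_sum {V a x₁ x₂ x₃ : ℝ} (h₁ : 0 ≤ x₁) (h₂ : 0 ≤ x₂) (h₃ : 0 ≤ x₃)
    (ha : a ≤ x₁ + x₂ + x₃) :
    tailFn V a ≤ 3 * (tailFn (V / 3) x₁ + tailFn (V / 3) x₂ + tailFn (V / 3) x₃) := by
  have hT₁ := tailFn_nonneg (V := V / 3) h₁
  have hT₂ := tailFn_nonneg (V := V / 3) h₂
  have hT₃ := tailFn_nonneg (V := V / 3) h₃
  by_cases hV : V < a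
  · rw [tailFn_of_lt hV]
    -- the largest of the three exceeds `V / 3` and is its own tail
    have key : ∀ {x y z : ℝ}, 0 ≤ y → 0 ≤ z → y ≤ x → z ≤ x → a ≤ x + y + z →
        a ≤ 3 * (tailFn (V / 3) x + tailFn (V / 3) y + tailFn (V / 3) z) := by
      intro x y z hy hz hyx hzx hsum
      have hx3 : V / 3 < x := by linarith
      rw [tailFn_of_lt hx3]
      linarith [tailFn_nonneg (V := V / 3) hy, tailFn_nonneg (V := V / 3) hz]
    rcases le_total x₂ x₁ with h21 | h12
    · rcases le_total x₃ x₁ with h31 | h13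
      · exact key h₂ h₃ h21 h31 ha
      · have := key h₁ h₂ h13 (h21.trans h13) (by linarith)
        linarith
    · rcases le_total x₃ x₂ with h32 | h23
      · have := key h₁ h₃ h12 h32 (by linarith)
        linarith
      · have := key h₁ h₂ (h12.trans h23) h23 (by linarith)
        linarith
  · rw [tailFn_of_le (not_lt.1 hV)]
    positivity

/-- The domination converted into tails: with `C' = max C 1`,
`𝟙{V < a} a ≤ 3C' (𝟙{V' < F¹} F¹ + 𝟙{V' < F²} F² + 𝟙{V' < Fcr} Fcr)`, `V' = V / (3C')`. -/
theorem tailFn_act_le {V a F₁ F₂ F₃ C : ℝ} (hF₁ : 0 ≤ F₁) (hF₂ : 0 ≤ F₂) (hF₃ : 0 ≤ F₃)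
    (hdom : a ≤ F₁ + C * (F₂ + F₃)) :
    tailFn V a ≤ 3 * max C 1 *
      (tailFn (V / (3 * max C 1)) F₁ + tailFn (V / (3 * max C 1)) F₂ + tailFn (V / (3 * max C 1)) F₃) := by
  set C' := max C 1 with hC'
  have hC'1 : 1 ≤ C' := le_max_right _ _
  have hC'0 : 0 < C' := one_pos.trans_le hC'1
  have hCC' : C ≤ C' := le_max_left _ _
  have hdom' : a ≤ C' * F₁ + C' * F₂ + C' * F₃ := by
    have h1 : F₁ ≤ C' * F₁ := le_mul_of_one_le_left hF₁ hC'1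
    have h2 : C * (F₂ + F₃) ≤ C' * (F₂ + F₃) := mul_le_mul_of_nonneg_right hCC' (add_nonneg hF₂ hF₃)
    linarith
  have h := tailFn_le_three_sum (V := V) (mul_nonneg hC'0.le hF₁) (mul_nonneg hC'0.le hF₂)
    (mul_nonneg hC'0.le hF₃) hdom'
  rw [tailFn_mul hC'0, tailFn_mul hC'0, tailFn_mul hC'0, div_div] at h
  calc tailFn V a ≤ 3 * (C' * tailFn (V / (3 * C')) F₁ + C' * tailFn (V / (3 * C')) F₂ +
        C' * tailFn (V / (3 * C')) F₃) := h
    _ = 3 * C' * (tailFn (V / (3 * C')) F₁ + tailFn (V / (3 * C')) F₂ + tailFn (V / (3 * C')) F₃) := by ring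

/-- Splitting the `lintegral` of `ofReal (c (A₁ + A₂ + A₃))` when `A₁, A₂` are a.e.-measurable and `c ≥ 0`. -/
theorem lintegral_ofReal_mul_add_three_le {α : Type*} [MeasurableSpace α] {μ : Measure α}
    {A₁ A₂ A₃ : α → ℝ} {c : ℝ} (hc : 0 ≤ c) (h₁ : AEMeasurable A₁ μ) (h₂ : AEMeasurable A₂ μ) :
    ∫⁻ x, ENNReal.ofReal (c * (A₁ x + A₂ x + A₃ x)) ∂μ ≤
      ENNReal.ofReal c * (∫⁻ x, ENNReal.ofReal (A₁ x) ∂μ + ∫⁻ x, ENNReal.ofReal (A₂ x) ∂μ +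
        ∫⁻ x, ENNReal.ofReal (A₃ x) ∂μ) := by
  have hm₁ : AEMeasurable (fun x => ENNReal.ofReal (A₁ x)) μ := h₁.ennreal_ofReal
  have hm₂ : AEMeasurable (fun x => ENNReal.ofReal (A₂ x)) μ := h₂.ennreal_ofReal
  calc ∫⁻ x, ENNReal.ofReal (c * (A₁ x + A₂ x + A₃ x)) ∂μ
      ≤ ∫⁻ x, ENNReal.ofReal c * (ENNReal.ofReal (A₁ x) + ENNReal.ofReal (A₂ x) + ENNReal.ofReal (A₃ x)) ∂μ := by
        refine lintegral_mono fun x => ?_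
        rw [ENNReal.ofReal_mul hc]
        refine mul_le_mul_right ?_ _
        exact ENNReal.ofReal_add_le.trans (add_le_add ENNReal.ofReal_add_le le_rfl)
    _ = ENNReal.ofReal c * ∫⁻ x, (ENNReal.ofReal (A₁ x) + ENNReal.ofReal (A₂ x) + ENNReal.ofReal (A₃ x)) ∂μ :=
        lintegral_const_mul' _ _ ENNReal.ofReal_ne_top
    _ = ENNReal.ofReal c * (∫⁻ x, ENNReal.ofReal (A₁ x) ∂μ + ∫⁻ x, ENNReal.ofReal (A₂ x) ∂μ +
        ∫⁻ x, ENNReal.ofReal (A₃ x) ∂μ) := by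
        rw [lintegral_add_left' (hm₁.fun_add hm₂), lintegral_add_left' hm₁]

/-! ## §3 The reduction -/

/-- **REDUCTION OF THE CRUX TO TWO TAIL STATEMENTS** (net theorem of line `SketchK1`): the crux-shaped tail statements of the
window-averaged near-field relative kinetic energy `F² = nearFieldKinetic` and of the crowded collisional activity
`Fcr = crowdedActivity` imply the tail statement of the activity `act` itself — i.e. the crux (`collisionActivityTails_iff_tailStatement_act`).
Proof: landed lever + landed endpoint tails + three-term tail algebra + splitting of the `lintegral`. -/
theorem tailStatement_act_of_tailStatements
    (hNF : TailStatement (fun Φ τ s i z => nearFieldKinetic Φ τ s i z))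
    (hCR : TailStatement (fun Φ τ s i z => crowdedActivity Φ τ s i z)) :
    TailStatement (fun Φ τ s i z => act Φ τ s i z) := by
  intro a₀ θ₀ u₀ ha hθ hu ha0 hθ0
  obtain ⟨C, hC0, hdom⟩ := stub_activityDomination
  obtain ⟨σ₁, hσ₁, hE⟩ := endpointTails_holds a₀ θ₀ u₀ ha hθ hu ha0 hθ0
  obtain ⟨σ₂, hσ₂, hNF⟩ := hNF a₀ θ₀ u₀ ha hθ hu ha0 hθ0
  obtain ⟨σ₃, hσ₃, hCR⟩ := hCR a₀ θ₀ u₀ ha hθ hu ha0 hθ0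
  refine ⟨min (min σ₁ σ₂) (min σ₃ (1 / 8)), lt_min (lt_min hσ₁ hσ₂) (lt_min hσ₃ (by norm_num)), ?_⟩
  intro σ hσ hσlt T ρ θ u hsol Φ hLLN t ht
  have hσ₁' : σ < σ₁ := hσlt.trans_le ((min_le_left _ _).trans (min_le_left _ _))
  have hσ₂' : σ < σ₂ := hσlt.trans_le ((min_le_left _ _).trans (min_le_right _ _))
  have hσ₃' : σ < σ₃ := hσlt.trans_le ((min_le_right _ _).trans (min_le_left _ _))
  have hσ8 : σ ≤ 1 / 8 := (hσlt.trans_le ((min_le_right _ _).trans (min_le_right _ _))).le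
  obtain ⟨V₂, hV₂, hNF⟩ := hNF σ hσ hσ₂' T ρ θ u hsol Φ hLLN t ht
  obtain ⟨V₃, hV₃, hCR⟩ := hCR σ hσ hσ₃' T ρ θ u hsol Φ hLLN t ht
  have hE := hE σ hσ hσ₁'
  -- constants of the tail algebra
  set C' : ℝ := max C 1 with hC'
  have hC'0 : 0 < C' := one_pos.trans_le (le_max_right _ _)
  have h3C' : 0 < 3 * C' := by positivity
  refine ⟨3 * C' * max V₂ V₃, by positivity, ?_⟩
  intro V hV e he
  -- reduced level and accuracy
  set V' : ℝ := V / (3 * C') with hV'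
  set e' : ℝ := e / (9 * C') with he'
  have hV'₂ : V₂ ≤ V' := by
    rw [hV', le_div_iff₀' h3C']
    exact (mul_le_mul_of_nonneg_left (le_max_left V₂ V₃) h3C'.le).trans hV
  have hV'₃ : V₃ ≤ V' := by
    rw [hV', le_div_iff₀' h3C']
    exact (mul_le_mul_of_nonneg_left (le_max_right V₂ V₃) h3C'.le).trans hV
  have hV'0 : 0 < V' := hV₂.trans_le hV'₂
  have he'0 : 0 < e' := by positivity
  obtain ⟨τ₁, hτ₁, hE⟩ := hE V' hV'0 e' he'0
  obtain ⟨τ₂, hτ₂, hNF⟩ := hNF V' hV'₂ e' he'0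
  obtain ⟨τ₃, hτ₃, hCR⟩ := hCR V' hV'₃ e' he'0
  refine ⟨max τ₁ (max τ₂ τ₃), lt_max_of_lt_left hτ₁, ?_⟩
  intro τ hτ
  have hτ₁' : τ₁ ≤ τ := (le_max_left _ _).trans hτ
  have hτ₂' : τ₂ ≤ τ := ((le_max_left _ _).trans (le_max_right _ _)).trans hτ
  have hτ₃' : τ₃ ≤ τ := ((le_max_right _ _).trans (le_max_right _ _)).trans hτ
  have hτ0 : 0 < τ := hτ₁.trans_le hτ₁'
  obtain ⟨N₂, hNF⟩ := hNF τ hτ₂'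
  obtain ⟨N₃, hCR⟩ := hCR τ hτ₃'
  refine ⟨max N₂ N₃, ?_⟩
  intro N hN s hs
  obtain ⟨hmE, hiE⟩ := hE τ hτ₁' N (Φ N) s
  have hiNF := hNF N ((le_max_left _ _).trans hN) s hs
  have hiCR := hCR N ((le_max_right _ _).trans hN) s hs
  have hmNF : AEMeasurable (fun z => ∑ i : Fin (N + 1), tailFn V' (nearFieldKinetic (Φ N) τ s i z))
      (localGibbsLaw σ a₀ u₀ θ₀ N (Φ N)) :=
    aemeasurable_sum_tailFn_nearFieldKinetic σ a₀ θ₀ u₀ N (Φ N) τ s V'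
  -- the three averaged tails
  set P := localGibbsLaw σ a₀ u₀ θ₀ N (Φ N) with hP
  set A₁ : Cfg N → ℝ := fun z =>
    ((N : ℝ) + 1)⁻¹ * ∑ i : Fin (N + 1), tailFn V' (endpointTerm (Φ N) τ s i z) with hA₁
  set A₂ : Cfg N → ℝ := fun z =>
    ((N : ℝ) + 1)⁻¹ * ∑ i : Fin (N + 1), tailFn V' (nearFieldKinetic (Φ N) τ s i z) with hA₂
  set A₃ : Cfg N → ℝ := fun z =>
    ((N : ℝ) + 1)⁻¹ * ∑ i : Fin (N + 1), tailFn V' (crowdedActivity (Φ N) τ s i z) with hA₃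
  have hmA₁ : AEMeasurable A₁ P := hmE.const_mul _
  have hmA₂ : AEMeasurable A₂ P := hmNF.const_mul _
  -- pointwise on the good set
  have hpt : ∀ z ∈ (Φ N).good,
      ((N : ℝ) + 1)⁻¹ * ∑ i : Fin (N + 1), tailFn V (act (Φ N) τ s i z) ≤ 3 * C' * (A₁ z + A₂ z + A₃ z) := by
    intro z hz
    have hsum : ∑ i : Fin (N + 1), tailFn V (act (Φ N) τ s i z) ≤
        ∑ i : Fin (N + 1), 3 * C' * (tailFn V' (endpointTerm (Φ N) τ s i z) +
          tailFn V' (nearFieldKinetic (Φ N) τ s i z) + tailFn V' (crowdedActivity (Φ N) τ s i z)) := by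
      refine Finset.sum_le_sum fun i _ => ?_
      have hF₁ : 0 ≤ endpointTerm (Φ N) τ s i z := by
        unfold endpointTerm relMomentumNear
        refine mul_nonneg (div_nonneg hσ.le hτ0.le) (add_nonneg ?_ ?_) <;>
          exact Finset.sum_nonneg fun j _ => by split_ifs <;> positivity
      exact tailFn_act_le hF₁ (nearFieldKinetic_nonneg (Φ N) hτ0 s i z)
        (crowdedActivity_nonneg hσ.le (Φ N) hτ0.le s i z) (hdom σ hσ hσ8 N (Φ N) τ hτ0 s z hz i)
    have hN1 : (0 : ℝ) ≤ ((N : ℝ) + 1)⁻¹ := by positivity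
    calc ((N : ℝ) + 1)⁻¹ * ∑ i : Fin (N + 1), tailFn V (act (Φ N) τ s i z)
        ≤ ((N : ℝ) + 1)⁻¹ * ∑ i : Fin (N + 1), 3 * C' * (tailFn V' (endpointTerm (Φ N) τ s i z) +
          tailFn V' (nearFieldKinetic (Φ N) τ s i z) + tailFn V' (crowdedActivity (Φ N) τ s i z)) :=
          mul_le_mul_of_nonneg_left hsum hN1
      _ = 3 * C' * (A₁ z + A₂ z + A₃ z) := by
          simp only [hA₁, hA₂, hA₃, ← Finset.mul_sum, Finset.sum_add_distrib]
          all_goals ring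
  have hae : ∀ᵐ z ∂P, ((N : ℝ) + 1)⁻¹ * ∑ i : Fin (N + 1), tailFn V (act (Φ N) τ s i z) ≤
      3 * C' * (A₁ z + A₂ z + A₃ z) := by
    filter_upwards [CollisionActivityTailsEndpointTails.ae_mem_good_localGibbsLaw σ a₀ θ₀ u₀ N (Φ N)] with z hz
      using hpt z hz
  -- integrate
  calc ∫⁻ z, ENNReal.ofReal (((N : ℝ) + 1)⁻¹ * ∑ i : Fin (N + 1), tailFn V (act (Φ N) τ s i z)) ∂P
      ≤ ∫⁻ z, ENNReal.ofReal (3 * C' * (A₁ z + A₂ z + A₃ z)) ∂P :=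
        lintegral_mono_ae (hae.mono fun z hz => ENNReal.ofReal_le_ofReal hz)
    _ ≤ ENNReal.ofReal (3 * C') * (∫⁻ z, ENNReal.ofReal (A₁ z) ∂P + ∫⁻ z, ENNReal.ofReal (A₂ z) ∂P +
        ∫⁻ z, ENNReal.ofReal (A₃ z) ∂P) := lintegral_ofReal_mul_add_three_le h3C'.le hmA₁ hmA₂
    _ ≤ ENNReal.ofReal (3 * C') * (ENNReal.ofReal e' + ENNReal.ofReal e' + ENNReal.ofReal e') := by
        exact mul_le_mul_right (add_le_add (add_le_add hiE hiNF) hiCR) _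
    _ = ENNReal.ofReal e := by
        rw [← ENNReal.ofReal_add he'0.le he'0.le, ← ENNReal.ofReal_add (by positivity) he'0.le,
          ← ENNReal.ofReal_mul h3C'.le]
        congr 1
        have hC'ne : C' ≠ 0 := hC'0.ne'
        rw [he']
        field_simp
        ring

-- buildfix 2026-08-19 (maintenance): `collisionActivityTails_of_tailStatements`, `collisionActivityTails_of_nearFieldKineticTails_of_crowded`,
-- `collisionActivityTails_of_oneWindow` and the registered helper `stub_collisionActivityTailsOfTails` REMOVED — all four concluded the
-- decl `TwoClocks.CollisionActivityTails`, DROPPED from route TwoClocks (route-repair rev 10ff.); the byte-identical OneFlightGossipEngine copy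
-- of the crux decl survives, and the reductions are re-targeted at it below (`…_oneFlight_…`, new names; statements otherwise verbatim).

/-- The same for the OneFlightGossipEngine copy of the crux decl. -/
theorem collisionActivityTails_oneFlight_of_tailStatements
    (hNF : TailStatement (fun Φ τ s i z => nearFieldKinetic Φ τ s i z))
    (hCR : TailStatement (fun Φ τ s i z => crowdedActivity Φ τ s i z)) :
    Summit.AtomisticToContinuum.HydrodynamicLimit.Theses.OneFlightGossipEngine.CollisionActivityTails :=
  collisionActivityTails_iff_tailStatement_act.2 (tailStatement_act_of_tailStatements hNF hCR)

/-- **The (OneFlightGossipEngine copy of the) crux from the line's two open stubs as LANDED statements**: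
`NearFieldKineticTails` (p106773, with its measurability conjunct) and `TailStatement Fcr` (≡ the skeleton's
`CrowdedCollisionTails`). -/
theorem collisionActivityTails_oneFlight_of_nearFieldKineticTails_of_crowded
    (hNF : CollisionActivityTailsNearFieldKineticTails.NearFieldKineticTails)
    (hCR : TailStatement (fun Φ τ s i z => crowdedActivity Φ τ s i z)) :
    Summit.AtomisticToContinuum.HydrodynamicLimit.Theses.OneFlightGossipEngine.CollisionActivityTails :=
  collisionActivityTails_oneFlight_of_tailStatements (nearFieldKineticTails_iff_tailStatement.1 hNF) hCR

/-- **ONE GOOD WINDOW FOR `F²` AND ONE FOR `Fcr` GIVE THE (OneFlightGossipEngine copy of the) CRUX**: by the landed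
one-window equivalences for the two window-convex functionals (p115960 `tailStatement_of_oneWindow`, p117971
`windowConvex_nearFieldKinetic` / `windowConvex_crowdedActivity`). -/
theorem collisionActivityTails_oneFlight_of_oneWindow
    (hNF : OneWindowTailStatement (fun Φ τ s i z => nearFieldKinetic Φ τ s i z))
    (hCR : OneWindowTailStatement (fun Φ τ s i z => crowdedActivity Φ τ s i z)) :
    Summit.AtomisticToContinuum.HydrodynamicLimit.Theses.OneFlightGossipEngine.CollisionActivityTails :=
  collisionActivityTails_oneFlight_of_tailStatements (tailStatement_of_oneWindow windowConvex_nearFieldKinetic hNF)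
    (tailStatement_of_oneWindow windowConvex_crowdedActivity hCR)

end Summit.AtomisticToContinuum.HydrodynamicLimit.Theorems.CollisionActivityTailsReduction

end
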